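import Mathlib
import Literature.MathematicalPhysics.QuantumLattice.FermiRG.Salmhofer1998DotCovDecay
import HarnessLib

/-!
# Salmhofer 1998, Lemma 5 — PROOF of the named fact `DotCovarianceL1Bound` (`‖Ḋ_t‖ ≤ Δ₂ e^{td}`)

M. Salmhofer, *Continuous renormalization for fermions and Fermi liquid theory*, Commun. Math. Phys.
**194** (1998) 249–295 = arXiv:cond-mat/9706188 [Salmhofer1998], §5.5 Lemma 5 (render
`paper:arxiv-cond-mat_9706188` p.20 L60–104; locators `p.N Ln` = chunk `pNNNN.txt` line `n`).

This theorem-only companion DISCHARGES licence F-086 of the FROZEN statement file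
`Salmhofer1998Sec5.lean` (t7, gate-hubbard-kl wave): `theorem DotCovarianceL1Bound_holds :
DotCovarianceL1Bound` (net debt `-1`; no definition, no new named fact).  Following the printed proof
(p.20 L86–91): the pointwise decay estimate (5.24) of the companion `Salmhofer1998DotCovDecay`
(`exists_dotCovPos_decay`, sup-norm form) is summed over `𝐱 ∈ εℤ^d` and integrated over
`x₀ ∈ [-β/2, β/2]`:

* "(5.26′)" `∫ d^d𝐱 (1+ε_t|𝐱|)^{-k₀} = ε_t^{-d} ∫ d^dξ (1+|ξ|)^{-k₀}` becomes the LATTICE-SUM bound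
  `Σ_{𝐧 ∈ ℤ^d} 1/max{1,(a‖𝐧‖_∞)^{k₀}} ≤ C_L a^{-d}` for `0 < a ≤ A₀` (`exists_lattice_sum_le`: compare each
  term with the integral of `(2max{1,A₀})^{k₀}/max{1,(a‖y‖_∞)^{k₀}}` over the unit cube `𝐧 + [0,1)^d`,
  the cubes tile `ℝ^d`, then scale `y = a⁻¹ξ` by the Haar-measure scaling and use Mathlib's
  integrability of `(1+‖ξ‖)^{-r}`, `r = k₀ > d`);
* "(5.26″)" `∫_{-β/2}^{β/2} dx₀ (1+ε_t min{…})^{-2} ≤ 4ε_t⁻¹ ∫_0^∞ du/(1+u)²` becomes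
  `∫_{[-β/2,β/2]} dx₀ / max{1,(ε_t x₀)²} ≤ ∫_ℝ 2dx₀/(1+(ε_t x₀)²) = 2π/ε_t`
  (`lintegral_inv_max_le`);
* hence `dotCovL1 ≤ 4 · ε^d · N ε_t · C_L (ε_t ε)^{-d} · 2π/ε_t = 8π N C_L ε_t^{-d} = 8π N C_L ε₀^{-d} e^{td}`,
  and `Δ₂ := 8π N C_L ε₀^{-d} + 1`.

Deviations from print (disclosed): sup norm `‖𝐱‖_∞` and `max{1,·}` weights instead of `|𝐱|` and
`(1+·)`; the volume constant `C_E` of toolkit III instead of `2J₁`; otherwise the architecture is the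
printed one.  No `instance`, no `notation`, no sorry/axiom; nothing about the Hubbard model is asserted
or denied.
-/

noncomputable section

open Filter Function MeasureTheory Set
open scoped Topology

namespace Literature.MathematicalPhysics.QuantumLattice.FermiRG

namespace Salmhofer1998

/-! ### The lattice sum `Σ_{𝐧∈ℤ^d} 1/max{1,(a‖𝐧‖)^K} ≤ C a^{-d}` -/

section Lattice

variable {d : ℕ}

/-- The unit cube `𝐧 + [0,1)^d`. [cite: Salmhofer1998, Lemma 5 proof (5.26′) (p.20 L86–88)] -/
theorem measurableSet_cube (nv : Fin d → ℤ) :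
    MeasurableSet (Set.pi Set.univ fun i : Fin d => Set.Ico (nv i : ℝ) ((nv i : ℝ) + 1)) :=
  MeasurableSet.univ_pi fun _ => measurableSet_Ico

/-- The unit cube has volume `1`. [cite: Salmhofer1998, Lemma 5 proof (5.26′) (p.20 L86–88)] -/
theorem volume_cube (nv : Fin d → ℤ) :
    volume (Set.pi Set.univ fun i : Fin d => Set.Ico (nv i : ℝ) ((nv i : ℝ) + 1)) = 1 := by
  rw [volume_pi_pi]
  simp [Real.volume_Ico]

/-- Distinct unit cubes are disjoint. [cite: Salmhofer1998, Lemma 5 proof (5.26′) (p.20 L86–88)] -/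
theorem pairwise_disjoint_cube :
    Pairwise (Disjoint on fun nv : Fin d → ℤ =>
      Set.pi Set.univ fun i : Fin d => Set.Ico (nv i : ℝ) ((nv i : ℝ) + 1)) := by
  intro nv nv' hne
  rw [Function.onFun, Set.disjoint_left]
  intro y hy hy'
  apply hne
  funext i
  have h1 := hy i (Set.mem_univ i)
  have h2 := hy' i (Set.mem_univ i)
  simp only [Set.mem_Ico] at h1 h2
  have e1 : ⌊y i⌋ = nv i := Int.floor_eq_iff.mpr ⟨h1.1, h1.2⟩
  have e2 : ⌊y i⌋ = nv' i := Int.floor_eq_iff.mpr ⟨h2.1, h2.2⟩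
  rw [← e1, ← e2]

/-- The unit cubes tile `ℝ^d`. [cite: Salmhofer1998, Lemma 5 proof (5.26′) (p.20 L86–88)] -/
theorem iUnion_cube_eq_univ :
    (⋃ nv : Fin d → ℤ, Set.pi Set.univ fun i : Fin d => Set.Ico (nv i : ℝ) ((nv i : ℝ) + 1)) =
      Set.univ := by
  ext y
  simp only [Set.mem_iUnion, Set.mem_pi, Set.mem_univ, true_implies, Set.mem_Ico, iff_true]
  exact ⟨fun i => ⌊y i⌋, fun i => ⟨Int.floor_le _, Int.lt_floor_add_one _⟩⟩

/-- On the cube `𝐧 + [0,1)^d`, `‖y‖ ≤ ‖𝐧‖ + 1`. [cite: Salmhofer1998, Lemma 5 proof (5.26′) (p.20 L86–88)] -/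
theorem norm_le_of_mem_cube {nv : Fin d → ℤ} {y : Fin d → ℝ}
    (hy : y ∈ Set.pi Set.univ fun i : Fin d => Set.Ico (nv i : ℝ) ((nv i : ℝ) + 1)) :
    ‖y‖ ≤ ‖(fun i => (nv i : ℝ) : Fin d → ℝ)‖ + 1 := by
  rw [pi_norm_le_iff_of_nonneg (by positivity)]
  intro i
  have h := hy i (Set.mem_univ i)
  simp only [Set.mem_Ico] at h
  have hn : ‖((nv i : ℝ))‖ ≤ ‖(fun i => (nv i : ℝ) : Fin d → ℝ)‖ := norm_le_pi_norm (fun i => (nv i : ℝ)) i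
  rw [Real.norm_eq_abs] at hn ⊢
  have := abs_le.mp (le_refl |(nv i : ℝ)|)
  rw [abs_le]
  constructor <;> linarith [abs_le.mp hn |>.1, abs_le.mp hn |>.2, le_abs_self (nv i : ℝ), neg_abs_le (nv i : ℝ)]

/-- The comparison weight `G(z) = 1/max{1,‖z‖^K}` is bounded by `2^K (1+‖z‖)^{-K}`.
[cite: Salmhofer1998, Lemma 5 proof (5.26′) (p.20 L86–88)] -/
theorem inv_max_le_rpow (K : ℕ) (z : Fin d → ℝ) :
    1 / max 1 (‖z‖ ^ K) ≤ (2 : ℝ) ^ K * (1 + ‖z‖) ^ (-(K : ℝ)) := by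
  have h0 : 0 ≤ ‖z‖ := norm_nonneg _
  have h1 : 0 < 1 + ‖z‖ := by linarith
  have hM : 0 < max 1 (‖z‖ ^ K) := by positivity
  have hP : 0 < (1 + ‖z‖) ^ K := by positivity
  have key : (1 + ‖z‖) ^ K ≤ (2 : ℝ) ^ K * max 1 (‖z‖ ^ K) := by
    rcases le_total ‖z‖ 1 with h | h
    · calc (1 + ‖z‖) ^ K ≤ (2 : ℝ) ^ K := by
            apply pow_le_pow_left₀ h1.le; linarith
        _ ≤ 2 ^ K * max 1 (‖z‖ ^ K) := le_mul_of_one_le_right (by positivity) (le_max_left _ _)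
    · calc (1 + ‖z‖) ^ K ≤ (2 * ‖z‖) ^ K := by
            apply pow_le_pow_left₀ h1.le; linarith
        _ = 2 ^ K * ‖z‖ ^ K := mul_pow _ _ _
        _ ≤ 2 ^ K * max 1 (‖z‖ ^ K) := by gcongr; exact le_max_right _ _
  rw [Real.rpow_neg h1.le, Real.rpow_natCast, ← div_eq_mul_inv, div_le_div_iff₀ hM hP, one_mul]
  exact key

/-- The comparison weight is integrable on `ℝ^d` when `K > d`. [cite: Salmhofer1998, Lemma 5 proof (5.26′) (p.20 L86–88)] -/
theorem integrable_inv_max {K : ℕ} (hK : d < K) :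
    Integrable (fun z : Fin d → ℝ => 1 / max 1 (‖z‖ ^ K)) := by
  have hint : Integrable (fun z : Fin d → ℝ => (2 : ℝ) ^ K * (1 + ‖z‖) ^ (-(K : ℝ))) := by
    apply Integrable.const_mul
    apply integrable_one_add_norm
    rw [Module.finrank_fin_fun]
    exact_mod_cast hK
  refine hint.mono' ?_ ?_
  · apply Measurable.aestronglyMeasurable
    apply Measurable.div measurable_const
    exact Measurable.max measurable_const ((continuous_norm.pow K).measurable)
  · refine Eventually.of_forall fun z => ?_
    rw [Real.norm_eq_abs, abs_of_nonneg (by positivity)]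
    exact inv_max_le_rpow K z

/-- Pointwise comparison on the cube `𝐧 + [0,1)^d`:
`1/max{1,(a‖𝐧‖)^K} ≤ (2max{1,A₀})^K / max{1,(a‖y‖)^K}` for `0 < a ≤ A₀`.
[cite: Salmhofer1998, Lemma 5 proof (5.26′) (p.20 L86–88)] -/
theorem inv_max_lattice_le {K : ℕ} {a A₀ : ℝ} (ha : 0 < a) (haA : a ≤ A₀) {nv : Fin d → ℤ}
    {y : Fin d → ℝ} (hy : y ∈ Set.pi Set.univ fun i : Fin d => Set.Ico (nv i : ℝ) ((nv i : ℝ) + 1)) :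
    1 / max 1 ((a * ‖(fun i => (nv i : ℝ) : Fin d → ℝ)‖) ^ K) ≤
      (2 * max 1 A₀) ^ K * (1 / max 1 ((a * ‖y‖) ^ K)) := by
  set r := ‖(fun i => (nv i : ℝ) : Fin d → ℝ)‖ with hr
  set s := ‖y‖ with hs
  have hr0 : 0 ≤ r := norm_nonneg _
  have hs0 : 0 ≤ s := norm_nonneg _
  have hsr : s ≤ r + 1 := norm_le_of_mem_cube hy
  have hM1 : 1 ≤ max 1 A₀ := le_max_left _ _
  have hc1 : (1 : ℝ) ≤ (2 * max 1 A₀) ^ K := one_le_pow₀ (by linarith)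
  rw [mul_one_div, div_le_div_iff₀ (by positivity) (by positivity), one_mul]
  -- `max(1,(as)^K) ≤ (2 max(1,A₀))^K max(1,(ar)^K)`
  rcases le_or_gt 1 r with h1 | h1
  · -- `r ≥ 1`: `s ≤ 2r`
    have hs2 : a * s ≤ 2 * max 1 A₀ * (a * r) := by
      have : s ≤ 2 * r := by linarith
      calc a * s ≤ a * (2 * r) := by gcongr
        _ = 2 * 1 * (a * r) := by ring
        _ ≤ 2 * max 1 A₀ * (a * r) := by gcongr
    refine max_le ?_ ?_
    · exact one_le_mul_of_one_le_of_one_le hc1 (le_max_left _ _)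
    · calc (a * s) ^ K ≤ (2 * max 1 A₀ * (a * r)) ^ K := pow_le_pow_left₀ (by positivity) hs2 K
        _ = (2 * max 1 A₀) ^ K * (a * r) ^ K := mul_pow _ _ _
        _ ≤ (2 * max 1 A₀) ^ K * max 1 ((a * r) ^ K) := by gcongr; exact le_max_right _ _
  · -- `r < 1`: `s < 2`, `(as)^K ≤ (2A₀)^K`
    have hs2 : a * s ≤ 2 * max 1 A₀ := by
      have : s ≤ 2 := by linarith
      calc a * s ≤ A₀ * 2 := mul_le_mul haA this hs0 (by linarith)
        _ ≤ max 1 A₀ * 2 := by gcongr; exact le_max_right _ _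
        _ = 2 * max 1 A₀ := by ring
    refine max_le ?_ ?_
    · exact one_le_mul_of_one_le_of_one_le hc1 (le_max_left _ _)
    · calc (a * s) ^ K ≤ (2 * max 1 A₀) ^ K := pow_le_pow_left₀ (by positivity) hs2 K
        _ ≤ (2 * max 1 A₀) ^ K * max 1 ((a * r) ^ K) :=
            le_mul_of_one_le_right (by positivity) (le_max_left _ _)

/-- **The lattice sum ("(5.26′)")**: for `K > d` and `A₀ > 0` there is `C ≥ 0` with
`Σ_{𝐧∈ℤ^d} 1/max{1,(a‖𝐧‖_∞)^K} ≤ C a^{-d}` for all `0 < a ≤ A₀` (the discrete counterpart of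
`∫ d^d𝐱 (1+ε_t|𝐱|)^{-k₀} = ε_t^{-d} ∫ d^dξ (1+|ξ|)^{-k₀}`).
[cite: Salmhofer1998, Lemma 5 proof (5.26′) (p.20 L86–88)] -/
theorem exists_lattice_sum_le {K : ℕ} (hK : d < K) (A₀ : ℝ) :
    ∃ C : ℝ, 0 ≤ C ∧ ∀ a : ℝ, 0 < a → a ≤ A₀ →
      ∑' nv : Fin d → ℤ, ENNReal.ofReal (1 / max 1 ((a * ‖(fun i => (nv i : ℝ) : Fin d → ℝ)‖) ^ K)) ≤
        ENNReal.ofReal (C * (a⁻¹) ^ d) := by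
  set G : (Fin d → ℝ) → ℝ := fun z => 1 / max 1 (‖z‖ ^ K) with hG
  have hGint : Integrable G := integrable_inv_max hK
  have hG0 : ∀ z, 0 ≤ G z := fun z => by simp only [hG]; positivity
  set IG : ℝ := ∫ z, G z with hIG
  have hIG0 : 0 ≤ IG := integral_nonneg hG0
  set cK : ℝ := (2 * max 1 A₀) ^ K with hcK
  have hcK0 : 0 ≤ cK := by positivity
  refine ⟨cK * IG, by positivity, fun a ha haA => ?_⟩
  set cube : (Fin d → ℤ) → Set (Fin d → ℝ) :=
    fun nv => Set.pi Set.univ fun i : Fin d => Set.Ico (nv i : ℝ) ((nv i : ℝ) + 1) with hcube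
  -- each term is the integral of a constant over its unit cube
  have hterm : ∀ nv : Fin d → ℤ,
      ENNReal.ofReal (1 / max 1 ((a * ‖(fun i => (nv i : ℝ) : Fin d → ℝ)‖) ^ K)) ≤
        ∫⁻ y in cube nv, ENNReal.ofReal (cK * G (a • y)) := by
    intro nv
    have h1 : ENNReal.ofReal (1 / max 1 ((a * ‖(fun i => (nv i : ℝ) : Fin d → ℝ)‖) ^ K)) =
        ∫⁻ _y in cube nv, ENNReal.ofReal (1 / max 1 ((a * ‖(fun i => (nv i : ℝ) : Fin d → ℝ)‖) ^ K)) := by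
      rw [setLIntegral_const, volume_cube, mul_one]
    rw [h1]
    refine setLIntegral_mono' (measurableSet_cube nv) fun y hy => ?_
    apply ENNReal.ofReal_le_ofReal
    have := inv_max_lattice_le (K := K) ha haA hy
    simp only [hG, norm_smul, Real.norm_eq_abs, abs_of_pos ha]
    exact this
  -- sum over cubes = integral over `ℝ^d`
  have hsum : ∑' nv : Fin d → ℤ, ∫⁻ y in cube nv, ENNReal.ofReal (cK * G (a • y)) =
      ∫⁻ y, ENNReal.ofReal (cK * G (a • y)) := by
    rw [← lintegral_iUnion (fun nv => measurableSet_cube nv) pairwise_disjoint_cube, iUnion_cube_eq_univ,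
      Measure.restrict_univ]
  -- the integral, by scaling
  have hscale : ∫⁻ y, ENNReal.ofReal (cK * G (a • y)) = ENNReal.ofReal (cK * IG * (a⁻¹) ^ d) := by
    have hint : Integrable (fun y : Fin d → ℝ => cK * G (a • y)) :=
      (hGint.comp_smul ha.ne').const_mul cK
    rw [← ofReal_integral_eq_lintegral_ofReal hint (Eventually.of_forall fun y => by
      simp only [Pi.zero_apply]; exact mul_nonneg hcK0 (hG0 _))]
    congr 1
    rw [integral_const_mul, Measure.integral_comp_smul, Module.finrank_fin_fun, smul_eq_mul,
      abs_of_nonneg (by positivity), inv_pow]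
    ring
  calc ∑' nv : Fin d → ℤ, ENNReal.ofReal (1 / max 1 ((a * ‖(fun i => (nv i : ℝ) : Fin d → ℝ)‖) ^ K))
      ≤ ∑' nv : Fin d → ℤ, ∫⁻ y in cube nv, ENNReal.ofReal (cK * G (a • y)) := ENNReal.tsum_le_tsum hterm
    _ = ENNReal.ofReal (cK * IG * (a⁻¹) ^ d) := by rw [hsum, hscale]

end Lattice

/-! ### The `x₀`-integral -/

/-- `1/max{1,u²} ≤ 2/(1+u²)`. [cite: Salmhofer1998, Lemma 5 proof (5.26″) (p.20 L89–91)] -/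
theorem inv_max_sq_le (u : ℝ) : 1 / max 1 (u ^ 2) ≤ 2 * (1 + u ^ 2)⁻¹ := by
  have hm : 0 < max 1 (u ^ 2) := by positivity
  have h1 : 0 < 1 + u ^ 2 := by positivity
  have key : 1 + u ^ 2 ≤ 2 * max 1 (u ^ 2) := by
    rcases le_total (u ^ 2) 1 with h | h
    · rw [max_eq_left h]; linarith
    · rw [max_eq_right h]; linarith
  rw [div_le_iff₀ hm]
  calc (1 : ℝ) = (1 + u ^ 2)⁻¹ * (1 + u ^ 2) := by field_simp
    _ ≤ (1 + u ^ 2)⁻¹ * (2 * max 1 (u ^ 2)) := by gcongr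
    _ = 2 * (1 + u ^ 2)⁻¹ * max 1 (u ^ 2) := by ring

/-- **("(5.26″)")** `∫_{[-β/2,β/2]} dx₀/max{1,(εx₀)²} ≤ 2π/ε` (via `∫_ℝ dx/(1+(εx)²) = π/ε`).
[cite: Salmhofer1998, Lemma 5 proof (5.26″) (p.20 L89–91)] -/
theorem lintegral_inv_max_le {ε : ℝ} (hε : 0 < ε) (β : ℝ) :
    ∫⁻ x₀ in Set.Icc (-(β / 2)) (β / 2), ENNReal.ofReal (1 / max 1 ((ε * |x₀|) ^ 2)) ≤
      ENNReal.ofReal (2 * Real.pi / ε) := by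
  have hint : Integrable (fun x : ℝ => 2 * (1 + (ε * x) ^ 2)⁻¹) :=
    (integrable_inv_one_add_sq.comp_mul_left' hε.ne').const_mul 2
  calc ∫⁻ x₀ in Set.Icc (-(β / 2)) (β / 2), ENNReal.ofReal (1 / max 1 ((ε * |x₀|) ^ 2))
      ≤ ∫⁻ x₀ in Set.Icc (-(β / 2)) (β / 2), ENNReal.ofReal (2 * (1 + (ε * x₀) ^ 2)⁻¹) := by
        refine lintegral_mono fun x₀ => ENNReal.ofReal_le_ofReal ?_
        rw [mul_pow, sq_abs, ← mul_pow]
        exact inv_max_sq_le (ε * x₀)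
    _ ≤ ∫⁻ x₀, ENNReal.ofReal (2 * (1 + (ε * x₀) ^ 2)⁻¹) := setLIntegral_le_lintegral _ _
    _ = ENNReal.ofReal (∫ x₀, 2 * (1 + (ε * x₀) ^ 2)⁻¹) :=
        (ofReal_integral_eq_lintegral_ofReal hint (Eventually.of_forall fun x => by positivity)).symm
    _ = ENNReal.ofReal (2 * Real.pi / ε) := by
        congr 1
        rw [integral_const_mul, Measure.integral_comp_mul_left (fun y => (1 + y ^ 2)⁻¹) ε,
          integral_univ_inv_one_add_sq, smul_eq_mul, abs_of_pos (inv_pos.mpr hε)]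
        ring

/-! ### Lemma 5 -/

/-- `‖ε𝐧‖_∞ = ε‖𝐧‖_∞` for the lattice vector `ε𝐧`. [cite: Salmhofer1998, §2.1 (p.5 L14)] -/
theorem norm_lattice_vec {d : ℕ} {latt : ℝ} (hl : 0 < latt) (nv : Fin d → ℤ) :
    ‖(fun i => latt * (nv i : ℝ) : Fin d → ℝ)‖ = latt * ‖(fun i => (nv i : ℝ) : Fin d → ℝ)‖ := by
  have : (fun i => latt * (nv i : ℝ) : Fin d → ℝ) = latt • (fun i => (nv i : ℝ) : Fin d → ℝ) := by
    funext i; simp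
  rw [this, norm_smul, Real.norm_eq_abs, abs_of_pos hl]

/-- `ε_t⁻ᵈ = ε₀⁻ᵈ e^{td}`. [cite: Salmhofer1998, §5.2 (5.8) (p.18 L19–25)] -/
theorem inv_epsT_pow (eps0 t : ℝ) (d : ℕ) :
    ((epsT eps0 t)⁻¹) ^ d = (eps0⁻¹) ^ d * Real.exp (t * d) := by
  unfold epsT
  rw [mul_inv, Real.exp_neg, inv_inv, mul_pow, ← Real.exp_nat_mul, mul_comm (d : ℝ) t]

/-- **Lemma 5** (Salmhofer 1998, p.20 L60–65): for the §2.3 class of models with `E ∈ C^{k₀}`, `k₀ > d`,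
there is `Δ₂ > 0` such that for all `t ≥ 0` and all `β` (`βε₀ ≥ 6`), `‖Ḋ_t‖ ≤ Δ₂ e^{td}` — DISCHARGE of
the named fact `DotCovarianceL1Bound` (licence F-086), proved along the printed lines: claim (5.24)
(companion `Salmhofer1998DotCovDecay`), then the lattice sum and the `x₀`-integral.
[cite: Salmhofer1998, Lemma 5 (p.20 L60–65), proof p.20 L66–104] -/
theorem DotCovarianceL1Bound_holds : DotCovarianceL1Bound := by
  intro d M hM hk χ₁ hχ
  obtain ⟨N, hN0, hN⟩ := exists_dotCovPos_decay hM hχ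
  obtain ⟨CL, hCL0, hCL⟩ := exists_lattice_sum_le (d := d) (K := M.k0) hk M.latt
  have h0 := hM.eps0_pos
  have hπ := Real.pi_pos
  have hl := hM.latt_pos
  refine ⟨8 * Real.pi * N * CL * (M.eps0⁻¹) ^ d + 1, by positivity, ?_⟩
  intro β hβ _ t ht
  set ε := epsT M.eps0 t with hεdef
  have hε : 0 < ε := epsT_pos h0 t
  have hε1 : ε ≤ 1 := epsT_le_one hM ht
  -- pointwise bound inside the sum, as a product of `ofReal`s
  have hpt : ∀ x₀ ∈ Set.Icc (-(β / 2)) (β / 2), ∀ nv : Fin d → ℤ,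
      ‖dotCovPos M χ₁ β t x₀ (fun i => M.latt * (nv i : ℝ))‖ₑ ≤
        ENNReal.ofReal (N * ε / max 1 ((ε * |x₀|) ^ 2)) *
          ENNReal.ofReal (1 / max 1 (((ε * M.latt) * ‖(fun i => (nv i : ℝ) : Fin d → ℝ)‖) ^ M.k0)) := by
    intro x₀ hx₀ nv
    have habs : |x₀| ≤ β / 2 := abs_le.mpr ⟨by linarith [hx₀.1], hx₀.2⟩
    have h := hN β hβ t ht x₀ habs nv
    rw [norm_lattice_vec hl nv, ← hεdef,
      show ε * (M.latt * ‖(fun i => (nv i : ℝ) : Fin d → ℝ)‖) =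
        ε * M.latt * ‖(fun i => (nv i : ℝ) : Fin d → ℝ)‖ by ring] at h
    rw [← ofReal_norm, ← ENNReal.ofReal_mul (by positivity)]
    apply ENNReal.ofReal_le_ofReal
    rw [div_mul_div_comm, mul_one]
    exact h
  -- the lattice sum
  have hsum : ∀ x₀ ∈ Set.Icc (-(β / 2)) (β / 2),
      ENNReal.ofReal (M.latt ^ d) *
          ∑' nv : Fin d → ℤ, ‖dotCovPos M χ₁ β t x₀ (fun i => M.latt * (nv i : ℝ))‖ₑ ≤
        ENNReal.ofReal (N * CL * ε * (ε⁻¹) ^ d) * ENNReal.ofReal (1 / max 1 ((ε * |x₀|) ^ 2)) := by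
    intro x₀ hx₀
    have ha : 0 < ε * M.latt := mul_pos hε hl
    have haA : ε * M.latt ≤ M.latt := by nlinarith
    have hL := hCL (ε * M.latt) ha haA
    calc ENNReal.ofReal (M.latt ^ d) *
          ∑' nv : Fin d → ℤ, ‖dotCovPos M χ₁ β t x₀ (fun i => M.latt * (nv i : ℝ))‖ₑ
        ≤ ENNReal.ofReal (M.latt ^ d) * ∑' nv : Fin d → ℤ,
            (ENNReal.ofReal (N * ε / max 1 ((ε * |x₀|) ^ 2)) *
              ENNReal.ofReal (1 / max 1 (((ε * M.latt) * ‖(fun i => (nv i : ℝ) : Fin d → ℝ)‖) ^ M.k0))) := by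
          gcongr ENNReal.ofReal (M.latt ^ d) * ?_
          exact ENNReal.tsum_le_tsum (hpt x₀ hx₀)
      _ = ENNReal.ofReal (M.latt ^ d) * (ENNReal.ofReal (N * ε / max 1 ((ε * |x₀|) ^ 2)) *
            ∑' nv : Fin d → ℤ,
              ENNReal.ofReal (1 / max 1 (((ε * M.latt) * ‖(fun i => (nv i : ℝ) : Fin d → ℝ)‖) ^ M.k0))) := by
          rw [ENNReal.tsum_mul_left]
      _ ≤ ENNReal.ofReal (M.latt ^ d) * (ENNReal.ofReal (N * ε / max 1 ((ε * |x₀|) ^ 2)) *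
            ENNReal.ofReal (CL * ((ε * M.latt)⁻¹) ^ d)) := by
          gcongr
      _ = ENNReal.ofReal (N * CL * ε * (ε⁻¹) ^ d) * ENNReal.ofReal (1 / max 1 ((ε * |x₀|) ^ 2)) := by
          rw [← ENNReal.ofReal_mul (by positivity), ← ENNReal.ofReal_mul (by positivity),
            ← ENNReal.ofReal_mul (by positivity)]
          congr 1
          have hld : M.latt ^ d * (M.latt⁻¹) ^ d = 1 := by
            rw [← mul_pow, mul_inv_cancel₀ hl.ne', one_pow]
          rw [mul_inv, mul_pow (ε⁻¹) (M.latt⁻¹) d]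
          calc M.latt ^ d * (N * ε / max 1 ((ε * |x₀|) ^ 2) * (CL * ((ε⁻¹) ^ d * (M.latt⁻¹) ^ d)))
              = (M.latt ^ d * (M.latt⁻¹) ^ d) * (N * CL * ε * (ε⁻¹) ^ d) *
                  (1 / max 1 ((ε * |x₀|) ^ 2)) := by ring
            _ = N * CL * ε * (ε⁻¹) ^ d * (1 / max 1 ((ε * |x₀|) ^ 2)) := by rw [hld, one_mul]
  -- integrate over `x₀`
  have hmeas : MeasurableSet (Set.Icc (-(β / 2)) (β / 2)) := measurableSet_Icc
  have hx₀int := lintegral_inv_max_le hε β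
  have hconst : 0 ≤ N * CL * ε * (ε⁻¹) ^ d := by positivity
  unfold dotCovL1
  calc 4 * ∫⁻ x₀ in Set.Icc (-(β / 2)) (β / 2), ENNReal.ofReal (M.latt ^ d) *
        ∑' nv : Fin d → ℤ, ‖dotCovPos M χ₁ β t x₀ (fun i => M.latt * (nv i : ℝ))‖ₑ
      ≤ 4 * ∫⁻ x₀ in Set.Icc (-(β / 2)) (β / 2),
          ENNReal.ofReal (N * CL * ε * (ε⁻¹) ^ d) * ENNReal.ofReal (1 / max 1 ((ε * |x₀|) ^ 2)) := by
        gcongr 4 * ?_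
        exact setLIntegral_mono' hmeas fun x₀ hx₀ => hsum x₀ hx₀
    _ = 4 * (ENNReal.ofReal (N * CL * ε * (ε⁻¹) ^ d) *
          ∫⁻ x₀ in Set.Icc (-(β / 2)) (β / 2), ENNReal.ofReal (1 / max 1 ((ε * |x₀|) ^ 2))) := by
        rw [lintegral_const_mul' _ _ ENNReal.ofReal_ne_top]
    _ ≤ 4 * (ENNReal.ofReal (N * CL * ε * (ε⁻¹) ^ d) * ENNReal.ofReal (2 * Real.pi / ε)) := by
        gcongr
    _ = ENNReal.ofReal (8 * Real.pi * N * CL * (ε⁻¹) ^ d) := by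
        rw [← ENNReal.ofReal_mul hconst, show (4 : ENNReal) = ENNReal.ofReal 4 by simp,
          ← ENNReal.ofReal_mul (by norm_num)]
        congr 1
        calc 4 * (N * CL * ε * (ε⁻¹) ^ d * (2 * Real.pi / ε))
            = 8 * Real.pi * N * CL * (ε⁻¹) ^ d * (ε / ε) := by ring
          _ = 8 * Real.pi * N * CL * (ε⁻¹) ^ d := by rw [div_self hε.ne', mul_one]
    _ ≤ ENNReal.ofReal ((8 * Real.pi * N * CL * (M.eps0⁻¹) ^ d + 1) * Real.exp (t * d)) := by
        apply ENNReal.ofReal_le_ofReal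
        rw [hεdef, inv_epsT_pow]
        have hexp : 0 ≤ Real.exp (t * d) := (Real.exp_pos _).le
        have hc : 0 ≤ 8 * Real.pi * N * CL * (M.eps0⁻¹) ^ d := by positivity
        nlinarith

end Salmhofer1998

end Literature.MathematicalPhysics.QuantumLattice.FermiRG
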